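import Mathlib
import Literature.Topology.FourManifolds.LefschetzHandlebody
import Literature.GroupTheory.CombinatorialGroupTheory.SignedHurwitzAction
import Literature.AlgebraicTopology.SingularHomology.SingularChains
import Literature.AlgebraicTopology.SingularHomology.ExcisionMayerVietoris
import HarnessLib

/-!
# The Lefschetz base of genus `0` is contractible; NF5 for `g = 0` and the empty word
(helper for stub `stub_isLefschetzHandlebody_homology` = NF5
`Literature.Topology.FourManifolds.LefschetzBase.isLefschetzHandlebody_homology` of line
`modp-braid-orbits`, reshape r9, crux `ConvexBisection.AcyclicBisectionExists`, item
stmt-SmoothPoincare4-10508, route route-SmoothPoincare4-ConvexBisection)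

The registered stub (Gompf–Stipsicz 1999 §8.2; Kas 1980 — unfolded over the concrete base
`Base g = {rho g ≤ 1/4} ⊂ ℂ²`, `rho g = ‖y² − x^{2g+1} − 1‖² + eta ‖x‖²`) says that a Lefschetz
handlebody `X(F_{g,1}; l)` (`IsLefschetzHandlebody g l X`) is connected, has
`H₁(X; ℤ) ≅ ℤ^{2g}/⟨letters l⟩`, and is ℚ-acyclic in positive degrees when `2g` classes span `ℚ^{2g}`.
Its degenerate instance `g = 0`, `l = []` reads: `X ≅ Base 0` is connected, `H₁(X; ℤ) ≅ ℤ⁰/⟨∅⟩ = 0`,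
and (`span ∅ = ⊤` in `ℚ⁰`, `0 = 2·0`) `H_k(X; ℚ) = 0` for `k > 0` — i.e. **`Base 0` is ℚ-acyclic**.
This file PROVES that instance (`stub_isLefschetzHandlebody_homology_zero_nil`, binders verbatim), via:

* `contractibleSpace_base_zero'` (private; the same statement is the NF3 worker's accepted
  `contractibleSpace_base_zero`, whose module is not yet built) — **`Base 0` is contractible.**  For
  `g = 0`, `(w, y)` with `w = y² − x − 1` are global holomorphic coordinates on `ℂ²`
  (`x = y² − 1 − w`), and
  `F_s : (w, y) ↦ (s w, s y)`, i.e. `F_s(x, y) = (s²y² − s y² + s x + s − 1, s y)`, keeps `rho ≤ 1/4`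
  (`‖w‖` scales by `s`; `‖x‖` stays below `max ‖x‖ 2` because `‖w‖ ≤ 1/2`, and `eta` vanishes below
  `‖x‖ = 2`), with `F_1 = id`, `F_0 ≡ (−1, 0)`: a contraction.
* `exists_isChainShadow_zero` — hence `H₁(Base 0; ℤ) = 0 = ℤ⁰` and the zero map is a chain shadow:
  the `g = 0` instance of the (unproved, Milnor 1968 Thm. 9.1) named fact
  `LefschetzBase.exists_isChainShadow` behind `shadowMap`.
* `nonempty_homeomorph_of_isLefschetzHandlebody_nil` — with no handles the multi-attachment is one
  surjective smooth open embedding `Base g ∖ ∅ → X`, so `X ≃ₜ Base g` (any `g`).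

The companion file `…StubLefschetzHandlebodyConnected.lean` proves clause (1) (connectedness) for
all `g`, `l`; the remaining clauses need the homotopy type of `Base g` (Milnor) and Mayer–Vietoris
over Kosinski multi-attachments.
-/

noncomputable section

-- the prescribed namespace `Summit.<P>.<Sub>.…` duplicates `SmoothPoincare4` (P = Sub)
set_option linter.dupNamespace false

open scoped Manifold ContDiff Topology
open Set Function CategoryTheory CategoryTheory.Limits
open Literature.GroupTheory.CombinatorialGroupTheory.SignedHurwitz Literature.Topology.FourManifolds
  Literature.Topology.FourManifolds.LefschetzBase Literature.AlgebraicTopology.SingularHomology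

namespace Summit.SmoothPoincare4.SmoothPoincare4.Theorems.AcyclicBisectionExists.ModpBraidOrbits

/-! ## §1 `Base 0 = {‖y² − x − 1‖² + eta ‖x‖² ≤ 1/4}` is contractible -/

/-- `rho 0` in complex coordinates: `rho 0 (a, b) = ‖b² − a − 1‖² + eta ‖a‖²`. [folklore] -/
theorem rho_zero_mk (a b : ℂ) : rho 0 (mk a b) = ‖b ^ 2 - a - 1‖ ^ 2 + eta (‖a‖ ^ 2) := by
  simp only [rho, w, Phi, cx_mk, cy_mk, mul_zero, zero_add, pow_one]

/-- `w 0 (x, y) = y² − x − 1`. [folklore] -/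
theorem w_zero_eq (p : EuclideanSpace ℝ (Fin 4)) : w 0 p = cy p ^ 2 - cx p - 1 := by
  simp only [w, Phi, mul_zero, zero_add, pow_one]

/-- **The standard Lefschetz base of genus `0` is contractible** (straight-line contraction in the
global coordinates `(w, y)`, `w = y² − x − 1`; on paper `Base 0 ≅ B⁴`).  A `private` copy: the same
statement, by the same contraction, is `contractibleSpace_base_zero` of the (accepted, not yet built)
companion `…StubModelsOnFibredBalanceGenusZero.lean` of the NF3 worker. [folklore] -/
private theorem contractibleSpace_base_zero' : ContractibleSpace (Base 0) := by
  -- the contraction `F_s(x, y) = (s²y² − s y² + s x + s − 1, s y)` and its coordinates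
  let F : ℝ → EuclideanSpace ℝ (Fin 4) → EuclideanSpace ℝ (Fin 4) := fun s p =>
    mk ((s : ℂ) ^ 2 * cy p ^ 2 - s * cy p ^ 2 + s * cx p + s - 1) (s * cy p)
  have hFw : ∀ s p, w 0 (F s p) = s * w 0 p := fun s p => by
    simp only [F, w_zero_eq, cx_mk, cy_mk]; ring
  have hFx : ∀ (s : ℝ) p, cx (F s p) = (s : ℂ) ^ 2 * cx p + ((s ^ 2 - 1 : ℝ) : ℂ) +
      ((s ^ 2 - s : ℝ) : ℂ) * w 0 p := fun s p => by
    simp only [F, w_zero_eq, cx_mk]; push_cast; ring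
  -- `‖x ∘ F_s‖ ≤ max ‖x‖ 2` on `‖w‖ ≤ 1/2`, for `0 ≤ s ≤ 1`
  have hnorm : ∀ s : ℝ, 0 ≤ s → s ≤ 1 → ∀ p, ‖w 0 p‖ ≤ 1 / 2 → ‖cx (F s p)‖ ≤ max ‖cx p‖ 2 := by
    intro s hs0 hs1 p hw
    set m := max ‖cx p‖ 2
    have hxm : ‖cx p‖ ≤ m := le_max_left _ _
    have h2m : 2 ≤ m := le_max_right _ _
    have key : (1 - s ^ 2) * 2 ≤ (1 - s ^ 2) * m := mul_le_mul_of_nonneg_left h2m (by nlinarith)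
    calc ‖cx (F s p)‖ ≤ ‖(s : ℂ) ^ 2 * cx p‖ + ‖(((s ^ 2 - 1 : ℝ) : ℂ))‖ +
          ‖((s ^ 2 - s : ℝ) : ℂ) * w 0 p‖ := by rw [hFx]; exact norm_add₃_le
      _ = s ^ 2 * ‖cx p‖ + (1 - s ^ 2) + (s - s ^ 2) * ‖w 0 p‖ := by
          rw [norm_mul, norm_mul, norm_pow, Complex.norm_real, Real.norm_eq_abs, abs_of_nonneg hs0,
            Complex.norm_real, Complex.norm_real, Real.norm_eq_abs, Real.norm_eq_abs,
            abs_of_nonpos (by nlinarith), abs_of_nonpos (by nlinarith)]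
          ring
      _ ≤ s ^ 2 * m + (1 - s ^ 2) + (s - s ^ 2) * (1 / 2) := by gcongr; nlinarith
      _ ≤ m := by nlinarith [key]
  -- `F_s` does not increase `rho 0` on the base
  have hrho : ∀ s : ℝ, 0 ≤ s → s ≤ 1 → ∀ p, rho 0 p ≤ 1 / 4 → rho 0 (F s p) ≤ rho 0 p := by
    intro s hs0 hs1 p hp
    have hw : ‖w 0 p‖ ≤ 1 / 2 := by nlinarith [(bounds_of_rho_le 0 hp).2, norm_nonneg (w 0 p)]
    have hx := hnorm s hs0 hs1 p hw
    have h1 : ‖w 0 (F s p)‖ ^ 2 ≤ ‖w 0 p‖ ^ 2 := by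
      rw [hFw, norm_mul, Complex.norm_real, Real.norm_eq_abs, abs_of_nonneg hs0, mul_pow]
      exact mul_le_of_le_one_left (sq_nonneg _) (pow_le_one₀ hs0 hs1)
    have h2 : eta (‖cx (F s p)‖ ^ 2) ≤ eta (‖cx p‖ ^ 2) := by
      rcases le_or_gt ‖cx (F s p)‖ 2 with hc | hc
      · rw [eta_of_le (by nlinarith [norm_nonneg (cx (F s p))])]
        exact eta_nonneg _
      · have hle : ‖cx (F s p)‖ ≤ ‖cx p‖ := by
          rcases le_total ‖cx p‖ 2 with h | h
          · rw [max_eq_right h] at hx; linarith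
          · rwa [max_eq_left h] at hx
        exact eta_monotone (by nlinarith [norm_nonneg (cx (F s p))])
    unfold rho
    linarith
  have hF1 : ∀ p, F 1 p = p := fun p => by
    conv_rhs => rw [← mk_cx_cy p]
    simp only [F, Complex.ofReal_one, one_pow, one_mul]
    congr 1
    ring
  have hF0 : ∀ p, F 0 p = mk (-1) 0 := fun p => by simp [F]
  have hFc : Continuous fun q : ℝ × EuclideanSpace ℝ (Fin 4) => F q.1 q.2 := by
    have hs : Continuous fun q : ℝ × EuclideanSpace ℝ (Fin 4) => (q.1 : ℂ) :=
      Complex.continuous_ofReal.comp continuous_fst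
    have hx : Continuous fun q : ℝ × EuclideanSpace ℝ (Fin 4) => cx q.2 :=
      contDiff_cx.continuous.comp continuous_snd
    have hy : Continuous fun q : ℝ × EuclideanSpace ℝ (Fin 4) => cy q.2 :=
      contDiff_cy.continuous.comp continuous_snd
    exact continuous_mk.comp ((((((hs.pow 2).mul (hy.pow 2)).sub (hs.mul (hy.pow 2))).add
      (hs.mul hx)).add hs |>.sub continuous_const).prodMk (hs.mul hy))
  -- the homotopy `(t, p) ↦ F_{1−t}(p)` from `id` to the constant map `(−1, 0)`
  have hmem : ∀ q : unitInterval × Base 0, F (1 - (q.1 : ℝ)) q.2.1 ∈ rho 0 ⁻¹' Iic (1 / 4 : ℝ) := by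
    intro q
    rw [mem_preimage, mem_Iic]
    have h0 : 0 ≤ 1 - (q.1 : ℝ) := by linarith [q.1.2.2]
    have h1 : 1 - (q.1 : ℝ) ≤ 1 := by linarith [q.1.2.1]
    exact (hrho _ h0 h1 _ q.2.2).trans q.2.2
  let b₀ : Base 0 := ⟨mk (-1) 0, by rw [mem_preimage, mem_Iic, rho_zero_mk]; norm_num [eta_of_le]⟩
  let H : ContinuousMap.Homotopy (ContinuousMap.id (Base 0)) (ContinuousMap.const (Base 0) b₀) :=
    { toFun := fun q => ⟨F (1 - (q.1 : ℝ)) q.2.1, hmem q⟩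
      continuous_toFun := (hFc.comp ((continuous_const.sub (continuous_subtype_val.comp
        continuous_fst)).prodMk (continuous_subtype_val.comp continuous_snd))).subtype_mk hmem
      map_zero_left := fun p => Subtype.ext (by
        show F (1 - ((0 : unitInterval) : ℝ)) p.1 = p.1
        rw [Set.Icc.coe_zero, sub_zero, hF1])
      map_one_left := fun p => Subtype.ext (by
        show F (1 - ((1 : unitInterval) : ℝ)) p.1 = mk (-1) 0
        rw [Set.Icc.coe_one, sub_self, hF0]) }
  exact (contractible_iff_id_nullhomotopic (Base 0)).2 ⟨b₀, ⟨H⟩⟩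

/-- **Milnor's Thm. 9.1 in genus `0`** (the degenerate instance of the named fact
`LefschetzBase.exists_isChainShadow`): `H₁(Base 0; ℤ) = 0 = ℤ⁰`, so the zero map is a chain shadow
(there are no chain loops to check). [folklore] -/
theorem exists_isChainShadow_zero : ∃ σ, IsChainShadow 0 σ := by
  haveI : ContractibleSpace (Base 0) := contractibleSpace_base_zero'
  haveI : Subsingleton (singularHomology ℤ ℤ (Base 0) 1) :=
    ModuleCat.subsingleton_of_isZero (isZero_singularHomology_of_contractibleSpace ℤ ℤ one_ne_zero)
  refine ⟨0, ⟨fun a b _ => Subsingleton.elim a b, fun v => ⟨0, Subsingleton.elim _ _⟩⟩, ?_⟩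
  intro i hi
  omega

/-! ## §2 A Lefschetz handlebody without handles is the base; NF5 at `g = 0`, `l = []` -/

/-- **No handles: `X(F_{g,1}; []) ≅ Base g`.**  A multi-attachment over the empty family is a single
smooth open embedding of `Base g ∖ ∅` onto `X`, hence a homeomorphism. [folklore] -/
theorem nonempty_homeomorph_of_isLefschetzHandlebody_nil {g : ℕ} {X : Type*} [TopologicalSpace X]
    [ChartedSpace (EuclideanHalfSpace 4) X]
    (hX : IsLefschetzHandlebody g ([] : List ((Fin g ⊕ Fin g → ℤ) × Bool)) X) :
    Nonempty (X ≃ₜ Base g) := by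
  obtain ⟨h, -, -, jA, jB, hA, -, -, hcover, -, -⟩ := hX
  haveI : IsEmpty (Fin ([] : List ((Fin g ⊕ Fin g → ℤ) × Bool)).length) :=
    inferInstanceAs (IsEmpty (Fin 0))
  have hsurj : Surjective jA := by
    rw [← range_eq_univ]
    rw [iUnion_of_empty, union_empty] at hcover
    exact hcover
  have hmem : ∀ p : Base g, p ∈ HandleAttachingMap.coresComplement h := fun p => by simp
  let e₂ : ↥(HandleAttachingMap.coresComplement h) ≃ₜ Base g :=
    { toFun := fun a => a.1
      invFun := fun p => ⟨p, hmem p⟩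
      left_inv := fun a => rfl
      right_inv := fun p => rfl
      continuous_toFun := continuous_subtype_val
      continuous_invFun := continuous_id.subtype_mk hmem }
  exact ⟨(IsHomeomorph.homeomorph jA (isHomeomorph_iff_isEmbedding_surjective.2
    ⟨hA.isEmbedding, hsurj⟩)).symm.trans e₂⟩

/-- The empty word carries no classes. [folklore] -/
theorem letters_nil {V : Type*} : letters ([] : List (V × Bool)) = ∅ := by
  ext v
  simp [letters]

/-- **NF5 in genus `0` for the empty word** — the registered signature of
`stub_isLefschetzHandlebody_homology` VERBATIM at `g = 0`, `l = []`: `X(F_{0,1}; []) ≅ Base 0` is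
contractible, hence connected, `H₁(X; ℤ) ≅ H₁(Base 0; ℤ) ≅ ℤ⁰ = ℤ⁰/⟨∅⟩` (through the genus-`0` chain
shadow), and ℚ-acyclic in positive degrees. [folklore] -/
theorem stub_isLefschetzHandlebody_homology_zero_nil :
    ∀ (X : Type) [TopologicalSpace X] [T2Space X] [SecondCountableTopology X] [CompactSpace X]
      [ChartedSpace (EuclideanHalfSpace 4) X] [IsManifold (𝓡∂ 4) ∞ X],
      IsLefschetzHandlebody 0 ([] : List ((Fin 0 ⊕ Fin 0 → ℤ) × Bool)) X →
      ConnectedSpace X ∧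
        Nonempty ((singularHomology ℤ ℤ X 1) ≃ₗ[ℤ]
          ((Fin 0 ⊕ Fin 0 → ℤ) ⧸ Submodule.span ℤ (letters ([] : List ((Fin 0 ⊕ Fin 0 → ℤ) × Bool))))) ∧
        (Submodule.span ℚ (letters (ratWord ([] : List ((Fin 0 ⊕ Fin 0 → ℤ) × Bool)))) = ⊤ →
          ([] : List ((Fin 0 ⊕ Fin 0 → ℤ) × Bool)).length = 2 * 0 →
          ∀ k, 0 < k → CategoryTheory.Limits.IsZero (singularHomology ℚ ℚ X k)) := by
  intro X _ _ _ _ _ _ hX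
  obtain ⟨e⟩ := nonempty_homeomorph_of_isLefschetzHandlebody_nil hX
  haveI : ContractibleSpace (Base 0) := contractibleSpace_base_zero'
  haveI : ContractibleSpace X := e.contractibleSpace
  refine ⟨inferInstance, ?_, fun _ _ k hk =>
    isZero_singularHomology_of_contractibleSpace ℚ ℚ (Nat.pos_iff_ne_zero.1 hk)⟩
  obtain ⟨hbij, -⟩ := isChainShadow_shadowMap 0 exists_isChainShadow_zero
  have hbot : Submodule.span ℤ (letters ([] : List ((Fin 0 ⊕ Fin 0 → ℤ) × Bool))) = ⊥ := by
    rw [letters_nil, Submodule.span_empty]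
  exact ⟨((singularHomology.mapIso ℤ ℤ e 1).toLinearEquiv.trans
    (LinearEquiv.ofBijective (shadowMap 0) hbij)).trans (Submodule.quotEquivOfEqBot _ hbot).symm⟩

end Summit.SmoothPoincare4.SmoothPoincare4.Theorems.AcyclicBisectionExists.ModpBraidOrbits
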